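import Literature.NumberTheory.Automorphic.AdelicSubLatticeClosed
import Literature.NumberTheory.Automorphic.AdelicGroupDataQuotientSubgroupProduct
import Literature.MeasureTheory.Group.InvariantQuotientChainRule
import Literature.NumberTheory.Automorphic.AdelicSecondCountable
import Literature.NumberTheory.Automorphic.GLnQuotientSubgroupHaar
import HarnessLib

/-!
# Unfolding a sub-lattice: `∫_{G ⧸ A_G Γ'} f = c ∫_{G ⧸ A_G Γ} Σ_{q ∈ (A_G Γ) ⧸ (A_G Γ')} f(g q)`
(Gelbart, *Automorphic forms on adele groups* (1975), §9.5–9.6: "applying the usual integration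
techniques", the passage from `Z_∞⁺ G_ℚ \ G_𝔸` to `Z_∞⁺ B_ℚ \ G_𝔸` and `Z_∞⁺ A_ℚ \ G_𝔸` in
(9.44), Lemma 9.11, Lemma 9.13, Prop. 9.17)

Topic `NumberTheory/Automorphic`; theorems only. For an adelic group datum `𝒢` with a continuous
central retraction (e.g. `GL_n`), a subgroup `Γ' ≤ Γ = G(K)` and the closed subgroup
`H' = A_G ⊔ Γ' = A_G · Γ'` (`AdelicSubLatticeClosed`):

* `AdelicGroupData.isOpen_subgroupOf_center'_sup` — `H'` is OPEN in `L = A_G · G(K)` (through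
  `L ≅ A_G × G(K)`, `quotientSubgroupEquivOfRetraction`, it is `A_G × Γ'` with `G(K)` discrete);
  hence `AdelicGroupData.discreteTopology_quotient_center'_sup` — the fibre `L ⧸ H'` is discrete
  (and countable); `AdelicGroupData.exists_quotient_center'_sup_equiv` — **`L ⧸ H' ≃ G(K) ⧸ Γ'`**,
  the identity on classes of rational elements (`ℓ ↦ θ(ℓ)⁻¹ ℓ`).
* `smulInvariantMeasure_count_of_discrete` — on a discrete coset space the counting measure is
  invariant.
* `AdelicGroupData.exists_lintegral_quotient_center'_sup_eq_mul_lintegral_tsum` — **the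
  unfolding**: for `G(𝔸)`-invariant non-zero Borel measures `μ'` on `G(𝔸) ⧸ H'` and `μ` on the
  automorphic quotient `G(𝔸) ⧸ L`, finite on compacta, there is `c ∈ (0, ∞)` with

    `∫_{G ⧸ H'} f dμ' = c ∫_{G ⧸ L} Σ'_{z ∈ L ⧸ H'} f(g • z) dμ(gL)`

  for every Borel `f ≥ 0` (integration in stages,
  `Literature.MeasureTheory.Group.InvariantQuotientChainRule`, with the counting measure on the
  discrete fibre). `GLn.exists_lintegral_quotient_center'_sup_eq_mul_lintegral_tsum` is the `GL_n`
  case (`A_G · B(K)`, `A_G · A(K)`, …).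

## References

* S. Gelbart, *Automorphic forms on adele groups*, Ann. of Math. Studies 83 (1975), §9.5–9.6
  [Gelbart1975].
* G. B. Folland, *A Course in Abstract Harmonic Analysis* (1995), §2.6 [Folland1995].
-/

noncomputable section

open NumberField IsDedekindDomain MeasureTheory Measure Topology
open Literature.MeasureTheory.Group
open scoped ENNReal NNReal Pointwise

/- Borel structures on coset spaces are supplied explicitly (house idiom of the quotient files). -/
attribute [-instance] Quotient.instMeasurableSpace QuotientGroup.measurableSpace

namespace Literature.NumberTheory.Automorphic

/-! ### Counting measure on a discrete coset space is invariant -/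

/-- On a coset space with the discrete σ-algebra, the counting measure is invariant under the
group. [folklore] -/
theorem smulInvariantMeasure_count_of_top {M X : Type*} [Group M] [MulAction M X]
    [MeasurableSpace X] (hX : ‹MeasurableSpace X› = ⊤) :
    SMulInvariantMeasure M X (count : Measure X) := by
  refine ⟨fun c s _ => ?_⟩
  have hms : ∀ t : Set X, MeasurableSet t := fun t => by rw [hX]; trivial
  rw [count_apply (hms _), count_apply (hms _), Set.preimage_smul, ← Set.image_smul,
    (MulAction.injective c⁻¹).encard_image]

namespace AdelicGroupData

universe u

variable {K : Type} [Field K] [NumberField K] (𝒢 : AdelicGroupData.{u} K)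
  (θ : 𝒢.Adelic →* 𝒢.Adelic) (hθA : ∀ g, θ g ∈ 𝒢.center') (hθa : ∀ a ∈ 𝒢.center', θ a = a)
  (hθγ : ∀ γ ∈ 𝒢.arithmeticSubgroup, θ γ = 1)

include hθA hθa hθγ in
/-- **`A_G · Γ'` is open in `L = A_G · G(K)`** for `Γ' ≤ G(K)` discrete: under
`L ≅ A_G × G(K)` it is `A_G × Γ'`. [folklore] -/
theorem isOpen_subgroupOf_center'_sup (hdisc : 𝒢.IsDiscreteRational) (hθc : Continuous θ)
    {Γ' : Subgroup 𝒢.Adelic} (hΓ' : Γ' ≤ 𝒢.arithmeticSubgroup) :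
    IsOpen (((𝒢.center' ⊔ Γ').subgroupOf 𝒢.quotientSubgroup : Subgroup 𝒢.quotientSubgroup) :
      Set 𝒢.quotientSubgroup) := by
  haveI : DiscreteTopology 𝒢.arithmeticSubgroup := hdisc
  set e := quotientSubgroupEquivOfRetraction 𝒢 θ hθA hθa hθγ hθc with he
  have hset : (((𝒢.center' ⊔ Γ').subgroupOf 𝒢.quotientSubgroup : Subgroup 𝒢.quotientSubgroup) :
      Set 𝒢.quotientSubgroup) =
      e ⁻¹' (Set.univ ×ˢ {γ : 𝒢.arithmeticSubgroup | (γ : 𝒢.Adelic) ∈ Γ'}) := by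
    ext h
    simp only [SetLike.mem_coe, Subgroup.mem_subgroupOf, Set.mem_preimage, Set.mem_prod,
      Set.mem_univ, true_and, Set.mem_setOf_eq]
    have key := Set.ext_iff.1 (coe_center'_sup_eq_preimage 𝒢 θ hθA hθa hθγ hΓ') (h : 𝒢.Adelic)
    simp only [SetLike.mem_coe, Set.mem_preimage] at key
    exact key
  rw [hset]
  exact (isOpen_univ.prod (isOpen_discrete _)).preimage e.continuous

include hθA hθa hθγ in
/-- The fibre `L ⧸ (A_G Γ')` of `G ⧸ A_G Γ' → G ⧸ L` is discrete. [folklore] -/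
theorem discreteTopology_quotient_center'_sup (hdisc : 𝒢.IsDiscreteRational) (hθc : Continuous θ)
    {Γ' : Subgroup 𝒢.Adelic} (hΓ' : Γ' ≤ 𝒢.arithmeticSubgroup) :
    DiscreteTopology (𝒢.quotientSubgroup ⧸
      ((𝒢.center' ⊔ Γ').subgroupOf 𝒢.quotientSubgroup : Subgroup 𝒢.quotientSubgroup)) :=
  QuotientGroup.discreteTopology (isOpen_subgroupOf_center'_sup 𝒢 θ hθA hθa hθγ hdisc hθc hΓ')

include hθA hθa hθγ in
/-- **Unfolding a sub-lattice** (integration in stages with a discrete fibre): for `Γ' ≤ G(K)`,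
`H' = A_G ⊔ Γ'`, `G(𝔸)`-invariant non-zero Borel measures `μ'` on `G(𝔸) ⧸ H'` and `μ` on
`G(𝔸) ⧸ L` finite on compacta, there is `c ∈ (0, ∞)` with
`∫ f dμ' = c ∫ (Σ'_{z ∈ L ⧸ H'} f(ỹ • z)) dμ(y)` for all Borel `f ≥ 0` (`ỹ = y.out` any
representative; the sum over the countable discrete fibre `L ⧸ H'`, embedded in `G(𝔸) ⧸ H'` by
`inclQuot`). [cite: Gelbart1975, §9.5] -/
theorem exists_lintegral_quotient_center'_sup_eq_mul_lintegral_tsum [LocallyCompactSpace 𝒢.Adelic]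
    [SecondCountableTopology 𝒢.Adelic] [T2Space 𝒢.Adelic] [MeasurableSpace 𝒢.Adelic]
    [BorelSpace 𝒢.Adelic] [Countable 𝒢.arithmeticSubgroup] (hdisc : 𝒢.IsDiscreteRational)
    (hθc : Continuous θ) {Γ' : Subgroup 𝒢.Adelic} (hΓ' : Γ' ≤ 𝒢.arithmeticSubgroup)
    [MeasurableSpace (𝒢.Adelic ⧸ (𝒢.center' ⊔ Γ'))] [BorelSpace (𝒢.Adelic ⧸ (𝒢.center' ⊔ Γ'))]
    [MeasurableSpace (𝒢.Adelic ⧸ 𝒢.quotientSubgroup)] [BorelSpace (𝒢.Adelic ⧸ 𝒢.quotientSubgroup)]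
    (μ' : Measure (𝒢.Adelic ⧸ (𝒢.center' ⊔ Γ')))
    [SMulInvariantMeasure 𝒢.Adelic (𝒢.Adelic ⧸ (𝒢.center' ⊔ Γ')) μ']
    [IsFiniteMeasureOnCompacts μ'] (hμ' : μ' ≠ 0)
    (μ : Measure (𝒢.Adelic ⧸ 𝒢.quotientSubgroup))
    [SMulInvariantMeasure 𝒢.Adelic (𝒢.Adelic ⧸ 𝒢.quotientSubgroup) μ]
    [IsFiniteMeasureOnCompacts μ] (hμ : μ ≠ 0) :
    ∃ c : ℝ≥0∞, c ≠ 0 ∧ c ≠ ∞ ∧ ∀ f : 𝒢.Adelic ⧸ (𝒢.center' ⊔ Γ') → ℝ≥0∞, Measurable f →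
      ∫⁻ x, f x ∂μ' = c * ∫⁻ y, ∑' z : 𝒢.quotientSubgroup ⧸
          ((𝒢.center' ⊔ Γ').subgroupOf 𝒢.quotientSubgroup : Subgroup 𝒢.quotientSubgroup),
        f ((Quotient.out y : 𝒢.Adelic) • inclQuot (𝒢.center' ⊔ Γ') 𝒢.quotientSubgroup z) ∂μ := by
  haveI : IsClosed ((𝒢.center' ⊔ Γ' : Subgroup 𝒢.Adelic) : Set 𝒢.Adelic) :=
    isClosed_center'_sup 𝒢 hdisc θ hθc hθA hθa hθγ hΓ'
  haveI : IsClosed (𝒢.quotientSubgroup : Set 𝒢.Adelic) :=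
    isClosed_quotientSubgroup_of_centralRetraction 𝒢 hdisc θ hθc hθA hθa hθγ
  haveI : DiscreteTopology (𝒢.quotientSubgroup ⧸
      ((𝒢.center' ⊔ Γ').subgroupOf 𝒢.quotientSubgroup : Subgroup 𝒢.quotientSubgroup)) :=
    discreteTopology_quotient_center'_sup 𝒢 θ hθA hθa hθγ hdisc hθc hΓ'
  -- the discrete σ-algebra on the discrete fibre, its (invariant) counting measure
  letI : MeasurableSpace (𝒢.quotientSubgroup ⧸
      ((𝒢.center' ⊔ Γ').subgroupOf 𝒢.quotientSubgroup : Subgroup 𝒢.quotientSubgroup)) := ⊤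
  haveI : BorelSpace (𝒢.quotientSubgroup ⧸
      ((𝒢.center' ⊔ Γ').subgroupOf 𝒢.quotientSubgroup : Subgroup 𝒢.quotientSubgroup)) :=
    ⟨(borel_eq_top_of_discrete).symm⟩
  haveI : SMulInvariantMeasure 𝒢.quotientSubgroup (𝒢.quotientSubgroup ⧸
      ((𝒢.center' ⊔ Γ').subgroupOf 𝒢.quotientSubgroup : Subgroup 𝒢.quotientSubgroup))
      (count : Measure _) := smulInvariantMeasure_count_of_top rfl
  have hms : ∀ s : Set (𝒢.quotientSubgroup ⧸
      ((𝒢.center' ⊔ Γ').subgroupOf 𝒢.quotientSubgroup : Subgroup 𝒢.quotientSubgroup)),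
      MeasurableSet s := fun _ => trivial
  haveI : IsFiniteMeasureOnCompacts (count : Measure (𝒢.quotientSubgroup ⧸
      ((𝒢.center' ⊔ Γ').subgroupOf 𝒢.quotientSubgroup : Subgroup 𝒢.quotientSubgroup))) :=
    ⟨fun s hs => by
      rw [count_apply (hms s)]
      exact ENat.toENNReal_lt_top.2 (hs.finite_of_discrete).encard_lt_top⟩
  have hcount : (count : Measure (𝒢.quotientSubgroup ⧸
      ((𝒢.center' ⊔ Γ').subgroupOf 𝒢.quotientSubgroup : Subgroup 𝒢.quotientSubgroup))) ≠ 0 := by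
    intro h
    have := congrArg (fun m : Measure _ => m {(QuotientGroup.mk 1 : 𝒢.quotientSubgroup ⧸
      ((𝒢.center' ⊔ Γ').subgroupOf 𝒢.quotientSubgroup : Subgroup 𝒢.quotientSubgroup))}) h
    simp only [Measure.coe_zero, Pi.zero_apply] at this
    rw [count_apply (hms _), Set.encard_singleton] at this
    simp at this
  obtain ⟨c, hc0, hctop, hc⟩ := exists_lintegral_eq_mul_lintegral_innerLIntegral
    (𝒢.center' ⊔ Γ') 𝒢.quotientSubgroup μ' μ count
    (sup_le 𝒢.center'_le_quotientSubgroup (hΓ'.trans 𝒢.arithmeticSubgroup_le_quotientSubgroup))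
    hμ' hμ hcount
  refine ⟨c, hc0, hctop, fun f hf => ?_⟩
  rw [hc f hf]
  congr 1
  refine lintegral_congr fun y => ?_
  conv_lhs => rw [← QuotientGroup.out_eq' y]
  rw [innerLIntegral_mk, lintegral_count]

/-- The inner integral against the counting measure is the sum over the fibre. [folklore] -/
theorem innerLIntegral_count_mk {G : Type*} [Group G] [TopologicalSpace G] [IsTopologicalGroup G]
    (H L : Subgroup G) [MeasurableSpace (L ⧸ H.subgroupOf L)] [BorelSpace (L ⧸ H.subgroupOf L)]
    [MeasurableSingletonClass (L ⧸ H.subgroupOf L)]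
    [SMulInvariantMeasure L (L ⧸ H.subgroupOf L) (count : Measure (L ⧸ H.subgroupOf L))]
    (f : G ⧸ H → ℝ≥0∞) (g : G) :
    innerLIntegral H L (count : Measure (L ⧸ H.subgroupOf L)) f (QuotientGroup.mk g) =
      ∑' z : L ⧸ H.subgroupOf L, f (g • inclQuot H L z) := by
  rw [innerLIntegral_mk, lintegral_count]

include hθA hθa hθγ in
/-- **The discrete fibre is `Γ ⧸ Γ'`**: `ℓ ↦ θ(ℓ)⁻¹ ℓ` induces a bijection
`L ⧸ (A_G Γ') ≃ G(K) ⧸ Γ'` with inverse induced by the inclusion `G(K) ≤ L`; on classes of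
rational elements it is the identity (`θ γ = 1`). [folklore] -/
theorem exists_quotient_center'_sup_equiv {Γ' : Subgroup 𝒢.Adelic} (hΓ' : Γ' ≤ 𝒢.arithmeticSubgroup) :
    ∃ e : (𝒢.arithmeticSubgroup ⧸ (Γ'.subgroupOf 𝒢.arithmeticSubgroup)) ≃
        (𝒢.quotientSubgroup ⧸ ((𝒢.center' ⊔ Γ').subgroupOf 𝒢.quotientSubgroup : Subgroup 𝒢.quotientSubgroup)),
      ∀ γ : 𝒢.arithmeticSubgroup,
        e (QuotientGroup.mk γ) = QuotientGroup.mk ⟨(γ : 𝒢.Adelic), 𝒢.arithmeticSubgroup_le_quotientSubgroup γ.2⟩ := by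
  have hmemH : ∀ x : 𝒢.Adelic, x ∈ 𝒢.center' ⊔ Γ' ↔ (θ x)⁻¹ * x ∈ Γ' := fun x => by
    have := Set.ext_iff.1 (coe_center'_sup_eq_preimage 𝒢 θ hθA hθa hθγ hΓ') x
    simpa only [SetLike.mem_coe, Set.mem_preimage] using this
  -- the inclusion `Γ ⧸ Γ' → L ⧸ H'`
  let ι : (𝒢.arithmeticSubgroup ⧸ (Γ'.subgroupOf 𝒢.arithmeticSubgroup)) →
      (𝒢.quotientSubgroup ⧸ ((𝒢.center' ⊔ Γ').subgroupOf 𝒢.quotientSubgroup : Subgroup 𝒢.quotientSubgroup)) :=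
    Quotient.map' (fun γ : 𝒢.arithmeticSubgroup =>
      (⟨(γ : 𝒢.Adelic), 𝒢.arithmeticSubgroup_le_quotientSubgroup γ.2⟩ : 𝒢.quotientSubgroup))
      fun a b hab => by
        rw [QuotientGroup.leftRel_apply, Subgroup.mem_subgroupOf] at hab ⊢
        change ((a : 𝒢.Adelic))⁻¹ * b ∈ 𝒢.center' ⊔ Γ'
        exact Subgroup.mem_sup_right (by simpa using hab)
  -- the retraction `L ⧸ H' → Γ ⧸ Γ'`
  let ρ : (𝒢.quotientSubgroup ⧸ ((𝒢.center' ⊔ Γ').subgroupOf 𝒢.quotientSubgroup : Subgroup 𝒢.quotientSubgroup)) →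
      (𝒢.arithmeticSubgroup ⧸ (Γ'.subgroupOf 𝒢.arithmeticSubgroup)) :=
    Quotient.map' (fun ℓ : 𝒢.quotientSubgroup =>
      (⟨(θ ℓ)⁻¹ * ℓ, inv_retraction_mul_mem 𝒢 θ hθA hθa hθγ ℓ.2⟩ : 𝒢.arithmeticSubgroup))
      fun a b hab => by
        rw [QuotientGroup.leftRel_apply, Subgroup.mem_subgroupOf] at hab ⊢
        change ((θ (a : 𝒢.Adelic))⁻¹ * a)⁻¹ * ((θ (b : 𝒢.Adelic))⁻¹ * b) ∈ Γ'
        have hab' : ((a : 𝒢.Adelic))⁻¹ * b ∈ 𝒢.center' ⊔ Γ' := hab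
        set x : 𝒢.Adelic := ((θ (a : 𝒢.Adelic))⁻¹ * a)⁻¹ * ((θ (b : 𝒢.Adelic))⁻¹ * b) with hxdef
        -- `x = (θa θb⁻¹) (a⁻¹ b)` with `θa θb⁻¹ ∈ A_G` central
        have hzA : θ (a : 𝒢.Adelic) * (θ (b : 𝒢.Adelic))⁻¹ ∈ 𝒢.center' :=
          mul_mem (hθA _) (inv_mem (hθA _))
        have hz : θ (a : 𝒢.Adelic) * (θ (b : 𝒢.Adelic))⁻¹ ∈ Subgroup.center 𝒢.Adelic :=
          𝒢.center'_le hzA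
        have hx : x = (θ (a : 𝒢.Adelic) * (θ (b : 𝒢.Adelic))⁻¹) * (((a : 𝒢.Adelic))⁻¹ * b) := by
          calc x = ((a : 𝒢.Adelic))⁻¹ * (θ (a : 𝒢.Adelic) * (θ (b : 𝒢.Adelic))⁻¹) * b := by
                simp only [hxdef, mul_inv_rev, inv_inv, mul_assoc]
            _ = (θ (a : 𝒢.Adelic) * (θ (b : 𝒢.Adelic))⁻¹) * ((a : 𝒢.Adelic))⁻¹ * b := by
                rw [Subgroup.mem_center_iff.1 hz ((a : 𝒢.Adelic))⁻¹]
            _ = _ := by rw [mul_assoc]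
        have hxH : x ∈ 𝒢.center' ⊔ Γ' := by
          rw [hx]; exact mul_mem (Subgroup.mem_sup_left hzA) hab'
        have hxΓ : x ∈ 𝒢.arithmeticSubgroup :=
          mul_mem (inv_mem (inv_retraction_mul_mem 𝒢 θ hθA hθa hθγ a.2))
            (inv_retraction_mul_mem 𝒢 θ hθA hθa hθγ b.2)
        have := (hmemH x).1 hxH
        rwa [hθγ x hxΓ, inv_one, one_mul] at this
  refine ⟨⟨ι, ρ, fun q => ?_, fun z => ?_⟩, fun γ => rfl⟩
  · induction q using QuotientGroup.induction_on with
    | H γ =>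
      change Quotient.mk'' _ = _
      apply congrArg
      apply Subtype.ext
      change (θ (γ : 𝒢.Adelic))⁻¹ * γ = γ
      rw [hθγ _ γ.2, inv_one, one_mul]
  · induction z using QuotientGroup.induction_on with
    | H ℓ =>
      change (QuotientGroup.mk _ : 𝒢.quotientSubgroup ⧸ _) = QuotientGroup.mk ℓ
      rw [QuotientGroup.eq, Subgroup.mem_subgroupOf]
      change ((θ (ℓ : 𝒢.Adelic))⁻¹ * ℓ)⁻¹ * ℓ ∈ 𝒢.center' ⊔ Γ'
      have hz : θ (ℓ : 𝒢.Adelic) ∈ Subgroup.center 𝒢.Adelic := 𝒢.center'_le (hθA _)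
      rw [mul_inv_rev, inv_inv, mul_assoc, ← Subgroup.mem_center_iff.1 hz (ℓ : 𝒢.Adelic),
        inv_mul_cancel_left]
      exact Subgroup.mem_sup_left (hθA _)

end AdelicGroupData

/-! ### `GL_n` -/

section GLn

variable (n : ℕ) (K : Type) [Field K] [NumberField K]

/-- **Unfolding a sub-lattice of `GL_n(K)`**: for `Γ' ≤ GL_n(K)` (e.g. `B(K)`, `A(K)`),
`G(𝔸) = GL_n(𝔸_K)`-invariant non-zero Borel measures `μ'` on `GL_n(𝔸_K) ⧸ A_G Γ'` and `μ` on the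
automorphic quotient, finite on compacta, there is `c ∈ (0, ∞)` with
`∫ f dμ' = c ∫ Σ'_{z ∈ L ⧸ A_G Γ'} f(ỹ • z) dμ(y)` for every Borel `f ≥ 0` (Gelbart (1975), §9.5:
`∫_{Z_∞⁺ G_ℚ \ G_𝔸} Σ_{δ ∈ B_ℚ \ G_ℚ} φ(δ x) dx = ∫_{Z_∞⁺ B_ℚ \ G_𝔸} φ`). The Borel structure on
`GL_n(𝔸_K)` is the consumer's (`adelicBorel`). [cite: Gelbart1975, §9.5] -/
theorem GLn.exists_lintegral_quotient_center'_sup_eq_mul_lintegral_tsum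
    [MeasurableSpace (AdelicGroupData.gl n K).Adelic] [BorelSpace (AdelicGroupData.gl n K).Adelic]
    {Γ' : Subgroup (AdelicGroupData.gl n K).Adelic}
    (hΓ' : Γ' ≤ (AdelicGroupData.gl n K).arithmeticSubgroup)
    [MeasurableSpace ((AdelicGroupData.gl n K).Adelic ⧸ ((AdelicGroupData.gl n K).center' ⊔ Γ'))]
    [BorelSpace ((AdelicGroupData.gl n K).Adelic ⧸ ((AdelicGroupData.gl n K).center' ⊔ Γ'))]
    [MeasurableSpace ((AdelicGroupData.gl n K).Adelic ⧸ (AdelicGroupData.gl n K).quotientSubgroup)]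
    [BorelSpace ((AdelicGroupData.gl n K).Adelic ⧸ (AdelicGroupData.gl n K).quotientSubgroup)]
    (μ' : Measure ((AdelicGroupData.gl n K).Adelic ⧸ ((AdelicGroupData.gl n K).center' ⊔ Γ')))
    [SMulInvariantMeasure (AdelicGroupData.gl n K).Adelic
      ((AdelicGroupData.gl n K).Adelic ⧸ ((AdelicGroupData.gl n K).center' ⊔ Γ')) μ']
    [IsFiniteMeasureOnCompacts μ'] (hμ' : μ' ≠ 0)
    (μ : Measure ((AdelicGroupData.gl n K).Adelic ⧸ (AdelicGroupData.gl n K).quotientSubgroup))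
    [SMulInvariantMeasure (AdelicGroupData.gl n K).Adelic
      ((AdelicGroupData.gl n K).Adelic ⧸ (AdelicGroupData.gl n K).quotientSubgroup) μ]
    [IsFiniteMeasureOnCompacts μ] (hμ : μ ≠ 0) :
    ∃ c : ℝ≥0∞, c ≠ 0 ∧ c ≠ ∞ ∧
      ∀ f : (AdelicGroupData.gl n K).Adelic ⧸ ((AdelicGroupData.gl n K).center' ⊔ Γ') → ℝ≥0∞,
        Measurable f →
        ∫⁻ x, f x ∂μ' = c * ∫⁻ y, ∑' z : (AdelicGroupData.gl n K).quotientSubgroup ⧸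
            (((AdelicGroupData.gl n K).center' ⊔ Γ').subgroupOf
              (AdelicGroupData.gl n K).quotientSubgroup :
                Subgroup (AdelicGroupData.gl n K).quotientSubgroup),
          f ((Quotient.out y : (AdelicGroupData.gl n K).Adelic) •
            inclQuot ((AdelicGroupData.gl n K).center' ⊔ Γ')
              (AdelicGroupData.gl n K).quotientSubgroup z) ∂μ := by
  haveI : T2Space (AdelicGroupData.gl n K).Adelic := t2Space_gl n K
  haveI : LocallyCompactSpace (AdelicGroupData.gl n K).Adelic :=
    AdelicGroupData.locallyCompactSpace_gl_adelic_holds n K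
  haveI : SecondCountableTopology (AdelicGroupData.gl n K).Adelic :=
    secondCountableTopology_gl_adelic n K
  obtain ⟨θ, hθc, hθA, hθa, hθγ⟩ := exists_centralRetraction_gl n K
  exact AdelicGroupData.exists_lintegral_quotient_center'_sup_eq_mul_lintegral_tsum _ θ hθA hθa hθγ
    (gl_isDiscreteRational_holds n K) hθc hΓ' μ' hμ' μ hμ

end GLn

end Literature.NumberTheory.Automorphic
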